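import Summits.AnomalousDissipation.AnomalousDissipation.Theorems.SolenoidalFractalHomogenisationLagrangianStepSidebandResponseExt
import Summits.AnomalousDissipation.AnomalousDissipation.Theorems.SolenoidalFractalHomogenisationLagrangianStepSidebandXDefs
import Summits.AnomalousDissipation.AnomalousDissipation.Theorems.SolenoidalFractalHomogenisationLagrangianStepW7ThreeModeFibre
import Mathlib.Analysis.Calculus.Deriv.Mul
import Mathlib.Analysis.Normed.Operator.BoundedLinearMaps
import HarnessLib

/-!
# K1L_D `LagrangianRenormalisationStepDesign` (stmt-AnomalousDissipation-27980), `stub_D1_V0` (V0 = clause (ii) of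
# `WCrossing.D1ExactFamily`), brick T4c-3c: THE REFERENCE RESPONSE IS TRANSVERSAL — `P_z (Nⱼ(t) v)_z = (Nⱼ(t) v)_z`
# (helper; `--kind proof --supports stmt-AnomalousDissipation-27980 --as helper`)

Summits-side helper file of route `SolenoidalFractalHomogenisation` (prover seat `ad-k1l-cellLawV-w1` g6).  Everything proved; no definitions, no named
facts, no sorry.  The defect groups of `…SidebandXResidual.hasDerivWithinAt_residual` are small only if the reference state `y = Σⱼ ξⱼ Nⱼ x` is
`z`-transversal (then the augmentation terms of `gen`/`genX` drop out and the viscous commutator is the transverse pairing of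
`…SidebandXDefectAlgebra.abs_re_visc_defect_le`).  Proof: the integer-lattice class projection `projX 1 0 R` (componentwise `P_z`) fixes the sources and
COMMUTES with the augmented generator `Sideband.gen` (`projX_gen_comm`: both sides are `−4π² P T P y_z − links(P-neighbours)`, the augmentation
`−γ₁(1 − P)` being killed on either side); hence `t ↦ P ∘ N t` is again a periodic response (`isPeriodicResponse_proj_comp`), and uniqueness
(`isPeriodicResponse_unique`, dissipativity) gives `P ∘ N = N` on `[0,P]` (**`proj_comp_response_eq`**), i.e. **`transversalProj_response_apply`** /
**`transversalProj_responseExt_apply`**: `P_z ((response t v) z) = (response t v) z` on `[0,P]`, and for `responseExt` at every `t`.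
NOT a proof of any registered stub, of K1L_D, or of anomalous dissipation; rung F-D1.A0 infrastructure.
-/

set_option linter.dupNamespace false

noncomputable section

namespace Summit.AnomalousDissipation.AnomalousDissipation.Theorems.SolenoidalFractalHomogenisation.LagrangianStep.Sideband

open Set MeasureTheory Complex UnitAddTorus Filter Topology
open scoped InnerProductSpace
open Literature.Analysis Literature.Analysis.FunctionSpaces Literature.Analysis.FunctionSpaces.Torus
open Literature.Analysis.FluidPDE Literature.Analysis.FluidPDE.Torus Literature.Analysis.FluidPDE.LatticeShear
open Summit.AnomalousDissipation.AnomalousDissipation.Theorems.SolenoidalFractalHomogenisation.PermissibleCarrier (period_pos)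
open Summit.AnomalousDissipation.AnomalousDissipation.Theorems.SolenoidalFractalHomogenisation.LagrangianStep.CellChain (linkCoeff)

variable {k₀ : ℕ}

/-! ## §1 The integer-lattice class projection -/

/-- Components of `projX 1 0 R`: `(projX 1 0 R y)_z = P_z y_z`. [cite: Temam1984, Ch. III §1.1] -/
theorem projX_one_zero_apply {R : ℕ} (y : Space R) (z : box R) : projX 1 0 R y z = transversalProj z.1 (y z) := by
  rw [projX_apply, classFreq_one_zero]

/-- The projection read through `coordL` and projected again: `P_w (coordL_w (projX 1 0 R y)) = P_w (coordL_w y)`. [cite: Temam1984, Ch. III §1.1] -/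
theorem transversalProj_coordL_projX {R : ℕ} (w : Fin 3 → ℤ) (y : Space R) :
    transversalProj w (coordL R w (projX 1 0 R y)) = transversalProj w (coordL R w y) := by
  by_cases hw : w ∈ box R
  · rw [coordL_apply_of_mem hw, coordL_apply_of_mem hw, projX_one_zero_apply, ThreeMode.transversalProj_idem]
  · rw [coordL_apply_of_not_mem hw, coordL_apply_of_not_mem hw]

/-- **The class projection fixes the sources** (they are `P_z`-valued). [cite: MajdaKramer1999, §2.2.1.3] -/
theorem projX_source {R : ℕ} (W₁ : LatticeWord k₀) (j : Fin k₀) (t : ℝ) (v : EuclideanSpace ℂ (Fin 3)) :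
    projX 1 0 R (source W₁ R j t v) = source W₁ R j t v := by
  apply PiLp.ext
  intro z
  rw [projX_one_zero_apply, source_apply, sourceComp, add_apply]
  by_cases h1 : z.1 = (W₁.phase j).m
  · by_cases h2 : z.1 = -(W₁.phase j).m
    · rw [if_pos h1, if_pos h2, map_add, smul_apply, smul_apply, map_smul, map_smul,
        ThreeMode.transversalProj_idem]
    · rw [if_pos h1, if_neg h2, zero_apply, add_zero, smul_apply, map_smul, ThreeMode.transversalProj_idem]
  · by_cases h2 : z.1 = -(W₁.phase j).m
    · rw [if_neg h1, if_pos h2, zero_apply, zero_add, smul_apply, map_smul, ThreeMode.transversalProj_idem]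
    · rw [if_neg h1, if_neg h2, zero_apply, add_zero, map_zero]

/-- **The class projection commutes with the augmented generator**: `projX 1 0 R (gen t y) = gen t (projX 1 0 R y)`. [cite: MajdaKramer1999, §2.2.1.3] -/
theorem projX_gen_comm {R : ℕ} (W₁ : LatticeWord k₀) (𝔸 : Torus.Visc4 (Fin 3)) (γ₁ : ℝ) (t : ℝ) (y : Space R) :
    projX 1 0 R (gen W₁ 𝔸 γ₁ R t y) = gen W₁ 𝔸 γ₁ R t (projX 1 0 R y) := by
  apply PiLp.ext
  intro z
  rw [projX_one_zero_apply, gen_apply, gen_apply, genComp_apply, genComp_apply]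
  simp only [coordL_apply_of_mem z.2, Subtype.coe_eta, projX_one_zero_apply, map_sub, map_neg, map_smul, map_sum, map_add,
    ThreeMode.transversalProj_idem, sub_self, smul_zero, sub_zero, transversalProj_coordL_projX]

/-! ## §2 Projecting a periodic response gives a periodic response -/

/-- **`P ∘ N` is a periodic response if `N` is.** [cite: SandersVerhulstMurdock2007, Lemma 5.2.7 (linear case)] -/
theorem isPeriodicResponse_proj_comp {R : ℕ} (W₁ : LatticeWord k₀) (𝔸 : Torus.Visc4 (Fin 3)) (γ₁ : ℝ) (j : Fin k₀)
    {N : ℝ → (EuclideanSpace ℂ (Fin 3) →L[ℝ] Space R)} (hN : IsPeriodicResponse W₁ 𝔸 γ₁ R j N) :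
    IsPeriodicResponse W₁ 𝔸 γ₁ R j (fun t => ((projX 1 0 R).restrictScalars ℝ).comp (N t)) := by
  obtain ⟨hc, hd, hp⟩ := hN
  refine ⟨?_, ?_, ?_⟩
  · exact continuousOn_const.clm_comp hc
  · intro t ht
    have h := (hasDerivAt_const t ((projX 1 0 R).restrictScalars ℝ)).clm_comp (hd t ht)
    rw [ContinuousLinearMap.zero_comp, zero_add] at h
    refine h.congr_deriv ?_
    apply ContinuousLinearMap.ext
    intro v
    simp only [ContinuousLinearMap.comp_apply, add_apply, ContinuousLinearMap.coe_restrictScalars', map_add,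
      projX_source, projX_gen_comm]
  · simp only [hp]

/-- **THE RESPONSE IS FIXED BY THE CLASS PROJECTION**: `P ∘ response t = response t` on `[0,P]` (uniqueness of the periodic response).
[cite: SandersVerhulstMurdock2007, Lemma 5.2.7 (linear case)] -/
theorem proj_comp_response_eq {R : ℕ} (W₁ : LatticeWord k₀) {𝔸 : Torus.Visc4 (Fin 3)} {lo' hi' : ℝ} (h𝔸 : Torus.NearIso 𝔸 lo' hi')
    (hlo' : 0 < lo') {γ₁ : ℝ} (hγ₁ : 0 < γ₁) (j : Fin k₀) {t : ℝ} (ht : t ∈ Icc 0 W₁.period) :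
    ((projX 1 0 R).restrictScalars ℝ).comp (response W₁ 𝔸 γ₁ R j t) = response W₁ 𝔸 γ₁ R j t := by
  have hN := isPeriodicResponse_response_of_nearIso W₁ h𝔸 hlo' hγ₁ R j
  exact isPeriodicResponse_unique W₁ h𝔸 hlo' hγ₁ (isPeriodicResponse_proj_comp W₁ 𝔸 γ₁ j hN) hN t ht

/-- **The response is transversal**: `P_z ((response t v) z) = (response t v) z` for `t ∈ [0,P]`. [cite: Temam1984, Ch. III §1.1] -/
theorem transversalProj_response_apply {R : ℕ} (W₁ : LatticeWord k₀) {𝔸 : Torus.Visc4 (Fin 3)} {lo' hi' : ℝ} (h𝔸 : Torus.NearIso 𝔸 lo' hi')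
    (hlo' : 0 < lo') {γ₁ : ℝ} (hγ₁ : 0 < γ₁) (j : Fin k₀) {t : ℝ} (ht : t ∈ Icc 0 W₁.period) (v : EuclideanSpace ℂ (Fin 3)) (z : box R) :
    transversalProj z.1 ((response W₁ 𝔸 γ₁ R j t v) z) = (response W₁ 𝔸 γ₁ R j t v) z := by
  have h := congrArg (fun L : EuclideanSpace ℂ (Fin 3) →L[ℝ] Space R => (L v) z) (proj_comp_response_eq W₁ h𝔸 hlo' hγ₁ j ht (R := R))
  simp only [ContinuousLinearMap.comp_apply, ContinuousLinearMap.coe_restrictScalars', projX_one_zero_apply] at h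
  exact h

/-- **The periodic extension is transversal at every time.** [cite: Temam1984, Ch. III §1.1] -/
theorem transversalProj_responseExt_apply {R : ℕ} (W₁ : LatticeWord k₀) {𝔸 : Torus.Visc4 (Fin 3)} {lo' hi' : ℝ} (h𝔸 : Torus.NearIso 𝔸 lo' hi')
    (hlo' : 0 < lo') {γ₁ : ℝ} (hγ₁ : 0 < γ₁) (j : Fin k₀) (t : ℝ) (v : EuclideanSpace ℂ (Fin 3)) (z : box R) :
    transversalProj z.1 ((responseExt W₁ 𝔸 γ₁ R j t v) z) = (responseExt W₁ 𝔸 γ₁ R j t v) z := by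
  rw [responseExt_def]
  exact transversalProj_response_apply W₁ h𝔸 hlo' hγ₁ j (Ico_subset_Icc_self (by simpa using toIcoMod_mem_Ico' (period_pos W₁) t)) v z

/-- The class-transversal version at `ℓ, n`: `projX 1 0 R (responseExt t v) = responseExt t v`. [cite: Temam1984, Ch. III §1.1] -/
theorem projX_responseExt {R : ℕ} (W₁ : LatticeWord k₀) {𝔸 : Torus.Visc4 (Fin 3)} {lo' hi' : ℝ} (h𝔸 : Torus.NearIso 𝔸 lo' hi')
    (hlo' : 0 < lo') {γ₁ : ℝ} (hγ₁ : 0 < γ₁) (j : Fin k₀) (t : ℝ) (v : EuclideanSpace ℂ (Fin 3)) :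
    projX 1 0 R (responseExt W₁ 𝔸 γ₁ R j t v) = responseExt W₁ 𝔸 γ₁ R j t v := by
  apply PiLp.ext
  intro z
  rw [projX_one_zero_apply, transversalProj_responseExt_apply W₁ h𝔸 hlo' hγ₁ j t v z]

end Summit.AnomalousDissipation.AnomalousDissipation.Theorems.SolenoidalFractalHomogenisation.LagrangianStep.Sideband

end
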